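import Summits.QuantumFields.BalabanUV.Beta.EriceRemainderEnclosureHistoryAutonomyComparisonAgeCompositionOldPairLetters

/-!
# EriceRemainderEnclosureHistoryAutonomyComparisonAgeCompositionOldBlockLetters — (E100a) route (N), first order: THE OLD-BLOCK LETTERS AND THE
# ARGMAX WINDOW.  An OLD BLOCK is any finite set of loaded ages `S ⊂ [lo, hi]`, `56 ≤ lo`, `hi ≤ 2·lo` (one octave).  At a pin `m` write
# `u_k = h_{m+k}`, `x_k = x_k(m) = k·L_ku_k³∕2`.  For every WINDOW `n ∈ S` the reads of the block over `[m, m+n)` are below ONE rise: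
#   `Σ_{i∈S} L_i · Σ_{q<n} h_{m+q+1+i} ≤ 1∕u_n²`                                            (**`block_window_reads_le`**, (E88d)),
# and every age's reads in the window are bounded BELOW by ray sums ((E99a) `ray_sum_ge`): a YOUNGER age `i < n` reads the stretch `(m+i, m+n]`
# under the ray through `m+i` and the far window `(m+n, m+n+i]` under the ray through `m+n` (**`young_reads_ge`**: `≥ c_a(n−i)u_i + c_b·i·u_n`),
# an OLDER (or equal) age `i ≥ n` reads `(m+i, m+i+n]` under the ray through `m+i` (**`old_reads_ge`**: `≥ c·n·u_i`).  So window `n` says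
# `Σ_i coef(i,n)·x_i ≤ 1` with `coef = 2c_a((n−i)∕i)∕σ² + 2c_b∕σ³` (`σ = u_i∕u_n`) on younger ages — the pair K-coefficient of (E99a) —, `2c·ρ`
# (`ρ = n·u_n²∕(i·u_i²) ≤ 1`) on older ages — the pair J-coefficient —, `2c_K` on itself.
# THE ARGMAX WINDOW.  Take `n ∈ S` MAXIMISING `k ↦ k^6·u_k^{14}` (i.e. `k^{6∕7}u_k²`).  Then for a younger `i`: `σ^{14} ≤ (n∕i)^6`, and for an
# older `i`: `ρ^7 ≥ n∕i`; and with `V = 5∕8` EVERY coefficient of window `n` is `≥ 1∕V` — for span `F ≤ 2` the two one-parameter conditions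
#   (K) `V·(2c_a(F)(F−1)F^{-6∕7} + 2c_b(F)F^{-9∕7}) ≥ 1`,   (J) `V·2c_b(F)·F^{-1∕7} ≥ 1`
# hold with slack `+0.0176` (K at `F = 1`: the single-age bound `2c_KV ≥ 1`) and `+0.0108` (J at `F = 2`) (`HOME/b2b-balaban-beta-d4-p2/g88/numerics/
# alpha1.py`; the exponent `6∕7` balances the two; `V = 0.617` would need `F ≤ 1.9`).  Hence `Σ_{k∈S} x_k ≤ V·Σ_k coef·x_k ≤ V` — the WHOLE OCTAVE
# carries one old age's worth, for ANY number of ages (the sequel (E100b) `…OldBlockCap`: box tables + the cap).  This file: the letters and the three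
# per-age BOX LEMMAS (pure side conditions, `norm_num`-checkable): **`young_in_old_window_of_box`**, **`old_in_young_window_of_box`**, **`own_window_le`**.

Cell `pub-balaban`, β-function sub-cell, BINDER row D4 «RemainderConst leaves for Bałaban's split» (`HOME/BINDER-OWNERS.md`; owner lineage `b2b-balaban-beta-an4`;
this file by co-owner #2 lineage `b2b-balaban-beta-d4-p2`, generation 88), β-FLOW TEAM duty (1), FREEZE (0) honoured (def-free; nothing restated).

HONEST FRAMING (page 1, verbatim and binding).  *"Discharging BetaPertH makes Bałaban's UV stability UNCONDITIONAL — a real constructive-QFT result; it is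
NOT the continuum limit and NOT the Clay problem."*  THIS FILE DISCHARGES NOTHING OF THE KIND.  Elementary real algebra ∕ real analysis about ABSTRACT
functionals on a box ]0,γ]^ℕ with displayed floors, profiles and signs, and the FIRST-ORDER renewal objects of route (N) built from them — hypotheses of a
census, not facts; the form, signs, ages and moments of Bałaban's (1.22) limit functional are NOT PRINTED ([I] p. 298; GAPS G-t4-U2-1∕-2) and NOT asserted.
Row D4 class UNCHANGED (critical-path width 0; instance 0∕1; D4 DISCHARGE NO DATE).  HONEST DEPENDENCY: continuum YM on T⁴ ⇐ BetaPertH ∧ nine spine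
estimates (0/9 proved); BetaPertH ⇐ (D1) ∧ (D4) ∧ CAP+tail; G-an2-4 gates asym, D1 and NE2/3/4.

THE POINT (README `HOME/b2b-balaban-beta-d4-p2/g88/README.md` §2).  Gen 87 found the letter-LP of an old block 2-sparse and the BLOCK DICHOTOMY (some own
window has all coefficients `≥ 1∕0.617`) without failure on 1540 triples × 13² grids and 4600 block configurations, and asked for a 2-parameter
certificate for triples.  The argmax removes the parameters: window `l` is certified by pair REGIMES alone iff `ρ_{il} ≤ τ_{il}` for younger `i` and
`ρ_{li} ≥ τ_{li}` for older `i`; with MULTIPLICATIVE thresholds `τ_{il} = (k_i∕k_l)^{1∕7}` and `ρ_{il} = p_i∕p_l` (`p = k·u²`) this reads `p_i∕q_i ≤ p_l∕q_l`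
(`q = k^{1∕7}`), so `l = argmax p∕q` is certified as soon as every PAIR dichotomy holds AT the threshold `F^{-1∕7}` — conditions (K), (J).  Uses (E99a)
`ray_sum_ge`, (E94b) `window_sum_ge`, (E88d) `invSq_sub_ge_all_reads`, (E79) `strictAnti_of_memFlow` BY NAME.  NOT CLAIMED: spans `> 2` (the same
conditions hold to `F = 2.41`, box tables not typed); `V < 5∕8`; anything printed — NOT B12 Thm 2, NOT BetaPertH, NOT continuum, NOT Clay.

WHAT IS PROVED ([folklore]; 0 `def`, 0 sorry).  §1 **`block_window_reads_le`**, **`young_reads_ge`**, **`old_reads_ge`**.  §2 **`young_in_old_window_of_box`**,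
**`old_in_young_window_of_box`**, **`own_window_le`** (each: `i·u_i³∕2 ≤ (5∕8)·u_n²·Σ_{q<n} h_{m+q+1+i}`).
-/
noncomputable section
open Finset

namespace Summit.QuantumFields.BalabanUV.Beta.EriceRemainderEnclosureHistoryAutonomyComparisonAgeCompositionOldBlockLetters

open Literature.MathematicalPhysics.QuantumFieldTheory.Balaban1983to89
open Literature.MathematicalPhysics.QuantumFieldTheory.Balaban1983to89.T4BetaStationary
open Literature.MathematicalPhysics.QuantumFieldTheory.Balaban1983to89.T4BetaFlowWellPosed
open Summit.QuantumFields.BalabanUV.Beta.EriceRemainderEnclosureHistoryAutonomyOrder (strictAnti_of_memFlow)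
open Summit.QuantumFields.BalabanUV.Beta.EriceRemainderEnclosureHistoryAutonomyComparisonAgeCompositionThreeAgesFlowReads (invSq_sub_ge_all_reads)
open Summit.QuantumFields.BalabanUV.Beta.EriceRemainderEnclosureHistoryAutonomyComparisonAgeCompositionYoungPairMoment (window_sum_ge)
open Summit.QuantumFields.BalabanUV.Beta.EriceRemainderEnclosureHistoryAutonomyComparisonAgeCompositionOldPairLetters (ray_sum_ge)

variable {B : (ℕ → ℝ) → ℝ} {γ b gIR : ℝ} {L : ℕ → ℝ} {K : ℕ} {h : ℕ → ℝ}

/-! ## §1 The block's reads in one window -/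

/-- **THE BLOCK'S READS IN ONE WINDOW ARE BELOW ONE RISE.**  A dominated profile `L ≥ 0` (`K` ages), `h` a box solution, any finite set of ages
`S ⊂ [0, K)` and any window `[m, m+n)`: `Σ_{i∈S} L_i·Σ_{q<n} h_{m+q+1+i} ≤ 1∕h_{m+n}²` — all reads over the window sum to at most the rise
`1∕h_{m+n}² − 1∕h_m²` ((E88d) `invSq_sub_ge_all_reads`), and the block's are some of them. [folklore] -/
theorem block_window_reads_le (hL : ∀ k, 0 ≤ L k) (hdom : ∀ u, SeqBox γ u → ∑ k ∈ range K, L k * u k ≤ B u) (hh : SeqBox γ h)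
    (hf : MemFlow B gIR h) {S : Finset ℕ} (hS : ∀ k ∈ S, k < K) (m n : ℕ) :
    ∑ i ∈ S, L i * ∑ q ∈ range n, h (m + q + 1 + i) ≤ 1 / h (m + n) ^ 2 := by
  have hpos : ∀ n, 0 < h n := fun n => (hh n).1
  have e1 := invSq_sub_ge_all_reads hdom hh hf m n
  have e2 : ∑ i ∈ S, L i * ∑ q ∈ range n, h (m + q + 1 + i) = ∑ q ∈ range n, ∑ i ∈ S, L i * h (m + q + 1 + i) := by
    rw [sum_comm]; exact sum_congr rfl fun i _ => mul_sum _ _ _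
  have e3 : ∀ q, ∑ i ∈ S, L i * h (m + q + 1 + i) ≤ ∑ i ∈ range K, L i * h (m + q + 1 + i) := fun q =>
    sum_le_sum_of_subset_of_nonneg (fun i hi => mem_range.2 (hS i hi)) fun i _ _ => mul_nonneg (hL i) (hpos _).le
  have e4 : 0 < 1 / h m ^ 2 := by have := hpos m; positivity
  rw [e2]
  linarith [sum_le_sum fun q (_ : q ∈ range n) => e3 q]

/-- **A YOUNGER AGE'S READS IN AN OLDER WINDOW.**  `B` an isotone memory with floor `b > 0`, `h` a box solution, ages `1 ≤ i < n`, constants with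
`c_a²(i+n+1) ≤ 2i` (the stretch `(m+i, m+n]` under the ray through `m+i`) and `c_b²(2n+i+1) ≤ 2n` (the far window `(m+n, m+n+i]` under the ray
through `m+n`): `c_a(n−i)h_{m+i} + c_b·i·h_{m+n} ≤ Σ_{q<n} h_{m+q+1+i}` ((E99a) `ray_sum_ge` twice). [folklore] -/
theorem young_reads_ge (hmono : ∀ u v : ℕ → ℝ, SeqBox γ u → SeqBox γ v → (∀ j, u j ≤ v j) → B u ≤ B v) (hb : 0 < b)
    (hlo : ∀ u, SeqBox γ u → b ≤ B u) (hh : SeqBox γ h) (hf : MemFlow B gIR h) {i n : ℕ} (hi : 1 ≤ i) (hin : i < n) {ca cb : ℝ}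
    (hca : ca ^ 2 * ((i : ℝ) + n + 1) ≤ 2 * i) (hcb : cb ^ 2 * (2 * (n : ℝ) + i + 1) ≤ 2 * n) (m : ℕ) :
    ca * ((n : ℝ) - i) * h (m + i) + cb * i * h (m + n) ≤ ∑ q ∈ range n, h (m + q + 1 + i) := by
  have hRa : ca * ((n - i : ℕ) : ℝ) * h (m + i) ≤ ∑ q ∈ range (n - i), h (m + i + 1 + q) :=
    ray_sum_ge hmono hb hlo hh hf hi (n - i) (by rw [Nat.cast_sub hin.le]; linarith [hca]) m
  have hRb : cb * i * h (m + n) ≤ ∑ q ∈ range i, h (m + n + 1 + q) := ray_sum_ge hmono hb hlo hh hf (by omega) i hcb m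
  have hsplit : ∑ q ∈ range n, h (m + q + 1 + i) = ∑ q ∈ range (n - i), h (m + i + 1 + q) + ∑ q ∈ range i, h (m + n + 1 + q) := by
    have hni : n = (n - i) + i := by omega
    conv_lhs => rw [hni]
    rw [sum_range_add]
    congr 1
    · exact sum_congr rfl fun q _ => by rw [show m + q + 1 + i = m + i + 1 + q by ring]
    · exact sum_congr rfl fun q _ => by rw [show m + (n - i + q) + 1 + i = m + n + 1 + q by omega]
  rw [Nat.cast_sub hin.le] at hRa
  rw [hsplit]
  linarith

/-- **AN OLDER AGE'S READS IN A YOUNGER WINDOW.**  `B` an isotone memory with floor `b > 0`, `h` a box solution, an age `i ≥ 1`, any window length `n`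
and any `c` with `c²(2i+n+1) ≤ 2i`: `c·n·h_{m+i} ≤ Σ_{q<n} h_{m+q+1+i}` — the `n` levels after `m+i` under the ray through `m+i` ((E99a) `ray_sum_ge`).
[folklore] -/
theorem old_reads_ge (hmono : ∀ u v : ℕ → ℝ, SeqBox γ u → SeqBox γ v → (∀ j, u j ≤ v j) → B u ≤ B v) (hb : 0 < b)
    (hlo : ∀ u, SeqBox γ u → b ≤ B u) (hh : SeqBox γ h) (hf : MemFlow B gIR h) {i : ℕ} (hi : 1 ≤ i) (n : ℕ) {c : ℝ}
    (hc : c ^ 2 * (2 * (i : ℝ) + n + 1) ≤ 2 * i) (m : ℕ) : c * n * h (m + i) ≤ ∑ q ∈ range n, h (m + q + 1 + i) := by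
  have := ray_sum_ge hmono hb hlo hh hf hi n hc m
  exact this.trans_eq (sum_congr rfl fun q _ => by rw [show m + i + 1 + q = m + q + 1 + i by ring])

/-! ## §2 The three per-age box lemmas of the argmax window (`V = 5∕8`) -/

/-- **A YOUNGER AGE IN THE ARGMAX WINDOW — ONE BOX OF THE SPAN (K side).**  Ages `56 ≤ i < n` with `F₁·i ≤ n ≤ F₂·i`, the argmax inequality
`i^6·h_{m+i}^{14} ≤ n^6·h_{m+n}^{14}` (so `σ = h_{m+i}∕h_{m+n} ≤ (n∕i)^{3∕7} ≤ sh`), and rational box constants `c_a, c_b, sh` with the displayed side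
conditions — validity of the stretch ∕ far-window tangent constants on the box for every `i ≥ 56`, `F₂³ ≤ sh⁷`, `(5∕4)c_a(F₁−1) ≤ 3`, and the CLOSURE
`sh³ ≤ (5∕4)(c_a(F₁−1)·sh + c_b)` (the K-coefficient `2c_a(F−1)∕σ² + 2c_b∕σ³ ≥ 8∕5` at the worst corner; between `σ = 1` and `σ = sh` by convexity of
the cube).  THEN `i·h_{m+i}³∕2 ≤ (5∕8)·h_{m+n}²·Σ_{q<n} h_{m+q+1+i}`. [folklore] -/
theorem young_in_old_window_of_box (hmono : ∀ u v : ℕ → ℝ, SeqBox γ u → SeqBox γ v → (∀ j, u j ≤ v j) → B u ≤ B v) (hb : 0 < b)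
    (hlo : ∀ u, SeqBox γ u → b ≤ B u) (hh : SeqBox γ h) (hf : MemFlow B gIR h) {i n : ℕ} (h56 : 56 ≤ i) (hin : i < n) (m : ℕ)
    {F₁ F₂ ca cb sh : ℝ} (hn1 : F₁ * i ≤ n) (hn2 : (n : ℝ) ≤ F₂ * i)
    (harg : (i : ℝ) ^ 6 * h (m + i) ^ 14 ≤ (n : ℝ) ^ 6 * h (m + n) ^ 14)
    (hbox : 1 ≤ F₁ ∧ 0 ≤ ca ∧ 0 ≤ cb ∧ 0 < sh ∧ ca ^ 2 * ((1 + F₂) * 56 + 1) ≤ 112 ∧ ca ^ 2 * (1 + F₂) ≤ 2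
      ∧ cb ^ 2 * (112 * F₁ + 57) ≤ 112 * F₁ ∧ cb ^ 2 ≤ 1 ∧ F₂ ^ 3 ≤ sh ^ 7 ∧ (5 / 4 : ℝ) * (ca * (F₁ - 1)) ≤ 3
      ∧ sh ^ 3 ≤ (5 / 4 : ℝ) * (ca * (F₁ - 1) * sh + cb)) :
    (i : ℝ) * h (m + i) ^ 3 / 2 ≤ (5 / 8 : ℝ) * (h (m + n) ^ 2 * ∑ q ∈ range n, h (m + q + 1 + i)) := by
  obtain ⟨hF1, hca0, hcb0, hsh, hc1a, hc1b, hc2a, hc2b, hc3, hc4, hc5⟩ := hbox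
  have hpos : ∀ n, 0 < h n := fun n => (hh n).1
  have hanti := (strictAnti_of_memFlow hb hlo hh hf).antitone
  have hir : (56 : ℝ) ≤ i := by exact_mod_cast h56
  have hinr : (i : ℝ) + 1 ≤ n := by exact_mod_cast hin
  have hipos : (0 : ℝ) < i := by linarith
  have hF2 : 1 ≤ F₂ := le_of_mul_le_mul_right (by linarith : (1 : ℝ) * i ≤ F₂ * i) hipos
  have hreads := young_reads_ge hmono hb hlo hh hf (by omega) hin (ca := ca) (cb := cb) ?_ ?_ m
  rotate_left
  · -- the stretch constant is valid on the box
    have h1 : ca ^ 2 * ((i : ℝ) + n + 1) ≤ ca ^ 2 * ((1 + F₂) * i + 1) := mul_le_mul_of_nonneg_left (by linarith) (sq_nonneg ca)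
    have h2 := mul_le_mul_of_nonneg_left hir (sub_nonneg.2 hc1b)
    nlinarith
  · -- the far-window constant is valid on the box
    have hE : 0 ≤ 2 * F₁ - 2 * cb ^ 2 * F₁ - cb ^ 2 := by nlinarith [sq_nonneg cb]
    have h1 := mul_le_mul_of_nonneg_left hn1 (by nlinarith : (0 : ℝ) ≤ 2 - 2 * cb ^ 2)
    have h2 := mul_le_mul_of_nonneg_left hir hE
    nlinarith
  set u := h (m + i) with hu_def
  set w := h (m + n) with hw_def
  set R := ∑ q ∈ range n, h (m + q + 1 + i) with hR_def
  have hu : 0 < u := hpos _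
  have hw : 0 < w := hpos _
  have hwu : w ≤ u := hanti (by omega)
  -- σ ≤ sh from the argmax inequality
  have hush : u ≤ sh * w := by
    have h1 : (n : ℝ) ^ 6 ≤ (F₂ * i) ^ 6 := pow_le_pow_left₀ (by positivity) hn2 6
    have h2 : F₂ ^ 6 ≤ sh ^ 14 := by
      calc F₂ ^ 6 = (F₂ ^ 3) ^ 2 := by ring
        _ ≤ (sh ^ 7) ^ 2 := pow_le_pow_left₀ (pow_nonneg (by linarith) 3) hc3 2
        _ = sh ^ 14 := by ring
    have h3 : (i : ℝ) ^ 6 * u ^ 14 ≤ (i : ℝ) ^ 6 * (sh * w) ^ 14 := by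
      calc (i : ℝ) ^ 6 * u ^ 14 ≤ (n : ℝ) ^ 6 * w ^ 14 := harg
        _ ≤ (F₂ * i) ^ 6 * w ^ 14 := mul_le_mul_of_nonneg_right h1 (by positivity)
        _ = F₂ ^ 6 * ((i : ℝ) ^ 6 * w ^ 14) := by ring
        _ ≤ sh ^ 14 * ((i : ℝ) ^ 6 * w ^ 14) := mul_le_mul_of_nonneg_right h2 (by positivity)
        _ = (i : ℝ) ^ 6 * (sh * w) ^ 14 := by ring
    exact le_of_pow_le_pow_left₀ (by norm_num) (by positivity) (le_of_mul_le_mul_left h3 (by positivity))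
  have hsh1 : 1 ≤ sh := by
    by_contra hlt
    push Not at hlt
    have : sh * w < 1 * w := mul_lt_mul_of_pos_right hlt hw
    linarith
  -- the cube under its chord: u³ ≤ A·u·w² + (5∕4)c_b·w³ with A = (5∕4)c_a(F₁−1)
  have hkey : u ^ 3 ≤ (5 / 4 : ℝ) * (ca * (F₁ - 1)) * u * w ^ 2 + (5 / 4 : ℝ) * cb * w ^ 3 := by
    have hq : 0 ≤ u ^ 2 + u * (sh * w) + (sh * w) ^ 2 - (5 / 4 : ℝ) * (ca * (F₁ - 1)) * w ^ 2 := by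
      have h1 : w ^ 2 ≤ u ^ 2 := pow_le_pow_left₀ hw.le hwu 2
      have h2 : w * w ≤ u * (sh * w) := mul_le_mul hwu (hwu.trans hush) hw.le hu.le
      have h3 : w ^ 2 ≤ (sh * w) ^ 2 := pow_le_pow_left₀ hw.le (hwu.trans hush) 2
      have h4 := mul_le_mul_of_nonneg_right hc4 (sq_nonneg w)
      nlinarith
    have hprod := mul_nonneg (sub_nonneg.2 hush) hq
    have hclo : w ^ 3 * sh ^ 3 ≤ w ^ 3 * ((5 / 4 : ℝ) * (ca * (F₁ - 1) * sh + cb)) := mul_le_mul_of_nonneg_left hc5 (by positivity)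
    have e : u ^ 3 - ((5 / 4 : ℝ) * (ca * (F₁ - 1)) * u * w ^ 2 + (5 / 4 : ℝ) * cb * w ^ 3)
        = -((sh * w - u) * (u ^ 2 + u * (sh * w) + (sh * w) ^ 2 - (5 / 4 : ℝ) * (ca * (F₁ - 1)) * w ^ 2))
          + (w ^ 3 * sh ^ 3 - w ^ 3 * ((5 / 4 : ℝ) * (ca * (F₁ - 1) * sh + cb))) := by ring
    linarith
  -- assemble: i·u³ ≤ (5∕4)·w²·(c_a(n−i)u + c_b·i·w) ≤ (5∕4)·w²·reads
  have hG : (F₁ - 1) * i ≤ (n : ℝ) - i := by linarith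
  have hA : (5 / 4 : ℝ) * (ca * (F₁ - 1)) * u * w ^ 2 * i ≤ (5 / 4 : ℝ) * ca * ((n : ℝ) - i) * u * w ^ 2 := by
    have h1 := mul_le_mul_of_nonneg_left hG (by positivity : (0 : ℝ) ≤ (5 / 4 : ℝ) * ca * u * w ^ 2)
    have e1 : (5 / 4 : ℝ) * (ca * (F₁ - 1)) * u * w ^ 2 * i = (5 / 4 : ℝ) * ca * u * w ^ 2 * ((F₁ - 1) * i) := by ring
    have e2 : (5 / 4 : ℝ) * ca * ((n : ℝ) - i) * u * w ^ 2 = (5 / 4 : ℝ) * ca * u * w ^ 2 * ((n : ℝ) - i) := by ring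
    linarith
  have hB : (i : ℝ) * u ^ 3 ≤ (5 / 4 : ℝ) * (w ^ 2 * (ca * ((n : ℝ) - i) * u + cb * i * w)) := by
    have h1 := mul_le_mul_of_nonneg_right hkey hipos.le
    have e1 : ((5 / 4 : ℝ) * (ca * (F₁ - 1)) * u * w ^ 2 + (5 / 4 : ℝ) * cb * w ^ 3) * i
        = (5 / 4 : ℝ) * (ca * (F₁ - 1)) * u * w ^ 2 * i + (5 / 4 : ℝ) * cb * w ^ 3 * i := by ring
    have e2 : (5 / 4 : ℝ) * (w ^ 2 * (ca * ((n : ℝ) - i) * u + cb * i * w))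
        = (5 / 4 : ℝ) * ca * ((n : ℝ) - i) * u * w ^ 2 + (5 / 4 : ℝ) * cb * w ^ 3 * i := by ring
    linarith
  have hC := mul_le_mul_of_nonneg_left hreads (by positivity : (0 : ℝ) ≤ (5 / 4 : ℝ) * w ^ 2)
  have e3 : (5 / 4 : ℝ) * w ^ 2 * (ca * ((n : ℝ) - i) * u + cb * i * w) = (5 / 4 : ℝ) * (w ^ 2 * (ca * ((n : ℝ) - i) * u + cb * i * w)) := by
    ring
  have e4 : (5 / 4 : ℝ) * w ^ 2 * R = 2 * ((5 / 8 : ℝ) * (w ^ 2 * R)) := by ring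
  linarith

/-- **AN OLDER AGE IN THE ARGMAX WINDOW — ONE BOX OF THE SPAN (J side).**  Ages `56 ≤ n < i` with `F₁·n ≤ i ≤ F₂·n`, the argmax inequality
`i^6·h_{m+i}^{14} ≤ n^6·h_{m+n}^{14}` (so `ρ = n·h_{m+n}²∕(i·h_{m+i}²) ≥ (n∕i)^{1∕7} ≥ sl`), and rational box constants `c_b, sl` with the displayed
side conditions — validity of the far-ray constant for every `n ≥ 56`, `sl⁷·F₂ ≤ 1`, and the CLOSURE `1 ≤ (5∕4)·c_b·sl` (the J-coefficient `2c_bρ ≥ 8∕5`).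
THEN `i·h_{m+i}³∕2 ≤ (5∕8)·h_{m+n}²·Σ_{q<n} h_{m+q+1+i}`. [folklore] -/
theorem old_in_young_window_of_box (hmono : ∀ u v : ℕ → ℝ, SeqBox γ u → SeqBox γ v → (∀ j, u j ≤ v j) → B u ≤ B v) (hb : 0 < b)
    (hlo : ∀ u, SeqBox γ u → b ≤ B u) (hh : SeqBox γ h) (hf : MemFlow B gIR h) {i n : ℕ} (h56 : 56 ≤ n) (hni : n < i) (m : ℕ)
    {F₁ F₂ cb sl : ℝ} (hi1 : F₁ * n ≤ i) (hi2 : (i : ℝ) ≤ F₂ * n)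
    (harg : (i : ℝ) ^ 6 * h (m + i) ^ 14 ≤ (n : ℝ) ^ 6 * h (m + n) ^ 14)
    (hbox : 1 ≤ F₁ ∧ 0 ≤ cb ∧ 0 < sl ∧ cb ^ 2 * (112 * F₁ + 57) ≤ 112 * F₁ ∧ cb ^ 2 ≤ 1 ∧ sl ^ 7 * F₂ ≤ 1 ∧ 1 ≤ (5 / 4 : ℝ) * cb * sl) :
    (i : ℝ) * h (m + i) ^ 3 / 2 ≤ (5 / 8 : ℝ) * (h (m + n) ^ 2 * ∑ q ∈ range n, h (m + q + 1 + i)) := by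
  obtain ⟨hF1, hcb0, hsl, hc2a, hc2b, hc3, hc4⟩ := hbox
  have hpos : ∀ n, 0 < h n := fun n => (hh n).1
  have hnr : (56 : ℝ) ≤ n := by exact_mod_cast h56
  have hnir : (n : ℝ) + 1 ≤ i := by exact_mod_cast hni
  have hnpos : (0 : ℝ) < n := by linarith
  set u := h (m + i) with hu_def
  set w := h (m + n) with hw_def
  have hu : 0 < u := hpos _
  have hw : 0 < w := hpos _
  -- the far-ray constant is valid on the box (older age `i ≥ F₁·n`, window `n ≥ 56`)
  have hcb : cb ^ 2 * (2 * (i : ℝ) + n + 1) ≤ 2 * i := by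
    have hE : 0 ≤ 2 * F₁ - 2 * cb ^ 2 * F₁ - cb ^ 2 := by nlinarith [sq_nonneg cb]
    have h1 := mul_le_mul_of_nonneg_left hi1 (by nlinarith : (0 : ℝ) ≤ 2 - 2 * cb ^ 2)
    have h2 := mul_le_mul_of_nonneg_left hnr hE
    nlinarith
  have hreads := old_reads_ge hmono hb hlo hh hf (by omega : 1 ≤ i) n hcb m
  -- ρ ≥ sl from the argmax inequality: (sl·i·u²)⁷ ≤ (n·w²)⁷
  have hrho : sl * i * u ^ 2 ≤ n * w ^ 2 := by
    have h1 : sl ^ 7 * (i : ℝ) ≤ n := by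
      have := mul_le_mul_of_nonneg_left hi2 (by positivity : (0 : ℝ) ≤ sl ^ 7)
      nlinarith
    have h2 : (sl * i * u ^ 2) ^ 7 ≤ ((n : ℝ) * w ^ 2) ^ 7 := by
      have h3 := mul_le_mul_of_nonneg_right h1 (by positivity : (0 : ℝ) ≤ (i : ℝ) ^ 6 * u ^ 14)
      have h4 := mul_le_mul_of_nonneg_left harg hnpos.le
      calc (sl * i * u ^ 2) ^ 7 = sl ^ 7 * (i : ℝ) * ((i : ℝ) ^ 6 * u ^ 14) := by ring
        _ ≤ (n : ℝ) * ((n : ℝ) ^ 6 * w ^ 14) := by linarith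
        _ = ((n : ℝ) * w ^ 2) ^ 7 := by ring
    exact le_of_pow_le_pow_left₀ (by norm_num) (by positivity) h2
  -- assemble: i·u³∕2 ≤ (5∕8)·w²·(c_b·n·u) ≤ (5∕8)·w²·reads
  have hB : (i : ℝ) * u ^ 2 ≤ (5 / 4 : ℝ) * cb * (n * w ^ 2) := by
    have := mul_le_mul_of_nonneg_right hc4 (by positivity : (0 : ℝ) ≤ (i : ℝ) * u ^ 2)
    have := mul_le_mul_of_nonneg_left hrho (by positivity : (0 : ℝ) ≤ (5 / 4 : ℝ) * cb)
    nlinarith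
  have hC := mul_le_mul_of_nonneg_left hreads (by positivity : (0 : ℝ) ≤ (5 / 8 : ℝ) * w ^ 2)
  have hD := mul_le_mul_of_nonneg_right hB hu.le
  nlinarith

/-- **THE ARGMAX WINDOW'S OWN AGE.**  An age `n ≥ 56`: `n·h_{m+n}³∕2 ≤ (5∕8)·h_{m+n}²·Σ_{q<n} h_{m+q+1+n}` — the own window under the ray ((E94b)
`window_sum_ge` with `c_K = 0.8104`, `c_K²(3n+1) ≤ 2n` from `n ≥ 23`; `(5∕4)·0.8104 = 1.013 ≥ 1`). [folklore] -/
theorem own_window_le (hmono : ∀ u v : ℕ → ℝ, SeqBox γ u → SeqBox γ v → (∀ j, u j ≤ v j) → B u ≤ B v) (hb : 0 < b)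
    (hlo : ∀ u, SeqBox γ u → b ≤ B u) (hh : SeqBox γ h) (hf : MemFlow B gIR h) {n : ℕ} (h56 : 56 ≤ n) (m : ℕ) :
    (n : ℝ) * h (m + n) ^ 3 / 2 ≤ (5 / 8 : ℝ) * (h (m + n) ^ 2 * ∑ q ∈ range n, h (m + q + 1 + n)) := by
  have hpos : ∀ n, 0 < h n := fun n => (hh n).1
  have hnr : (56 : ℝ) ≤ n := by exact_mod_cast h56
  have hw := hpos (m + n)
  have hcK : ((1013 : ℝ) / 1250) ^ 2 * (3 * (n : ℝ) + 1) ≤ 2 * n := by nlinarith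
  have hW := window_sum_ge hmono hb hlo hh hf (by omega : 1 ≤ n) hcK m
  have hW' : (1013 : ℝ) / 1250 * n * h (m + n) ≤ ∑ q ∈ range n, h (m + q + 1 + n) :=
    hW.trans_eq (sum_congr rfl fun q _ => by rw [show m + n + 1 + q = m + q + 1 + n by ring])
  have hC := mul_le_mul_of_nonneg_left hW' (by positivity : (0 : ℝ) ≤ (5 / 8 : ℝ) * h (m + n) ^ 2)
  nlinarith [mul_pos (by positivity : (0 : ℝ) < (n : ℝ)) (pow_pos hw 3)]

end Summit.QuantumFields.BalabanUV.Beta.EriceRemainderEnclosureHistoryAutonomyComparisonAgeCompositionOldBlockLetters
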